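import Literature.RingTheory.Etale.EtaleCoproduct
import Mathlib.RingTheory.Localization.AtPrime.Basic
import HarnessLib

/-!
# Ind-étale covers absorbing all faithfully flat étale covers

Stacks Project, Tag 097R (`lemma-first-construction`): for a ring `X` there is a faithfully flat
ind-étale `X`-algebra `C = colim Tⁿ(X)` such that **every faithfully flat étale `C`-algebra has a
retraction**. Here `T(X) = colim_E B_E` is the coproduct (tensor product) of all faithfully flat
étale `X`-algebras presented as quotients of polynomial rings (`EtaleCoproduct.lean`), and
`Tⁿ⁺¹(X) = T(Tⁿ(X))`.

* `FFEtalePres X`, `ECover X` (= `T(X)`): ind-étale (`ECover.factorsEtale`), faithfully flat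
  (`ECover.faithfullyFlat`), absorbing every faithfully flat étale `X`-algebra (`ECover.absorb`);
* `EStage X n = Tⁿ(X)` (bundled recursion), `ETower X = colim_n Tⁿ(X)` with
  `ETower.factorsEtale`, `ETower.faithfullyFlat`;
* `ETower.retraction` — **the retraction property** (Tag 097R): an étale faithfully flat
  `ETower X`-algebra descends to some `Tⁿ(X)` (Noetherian model + compactness), is absorbed by
  `Tⁿ⁺¹(X)`, whence a retraction.

The local consequence (local rings at maximal ideals are strictly henselian, Tag 097V) is drawn
in `EtaleClosedLocal.lean` in the pointed-retraction form used by Olivier's theorem.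

## References

* The Stacks Project, Tags 097R, 097V. [StacksProject]
* B. Bhatt, P. Scholze, *The pro-étale topology for schemes*, Astérisque 369 (2015), §2.2
  (w-strictly local covers). [BhattScholze2015]
-/

universe u

namespace Literature.RingTheory.Etale

open TensorProduct

/-! ### Presentations of faithfully flat étale algebras and the cover `T(X)` -/

variable (X : Type u) [CommRing X]

/-- A **presentation of a faithfully flat étale `X`-algebra** as `X[x₁,…,xₙ]/I` (these form a
set indexing all faithfully flat étale `X`-algebras up to isomorphism). [cite: StacksProject, Tag 097R] -/
structure FFEtalePres : Type u where
  /-- number of variables -/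
  n : ℕ
  /-- the ideal of relations -/
  I : Ideal (MvPolynomial (Fin n) X)
  /-- the quotient is étale … -/
  etale : Algebra.Etale X (MvPolynomial (Fin n) X ⧸ I)
  /-- … and faithfully flat -/
  faithfullyFlat : Module.FaithfullyFlat X (MvPolynomial (Fin n) X ⧸ I)

namespace FFEtalePres

variable {X}

/-- The algebra of a presentation is étale. [folklore] -/
instance etale_block (s : FFEtalePres X) : Algebra.Etale X (Block (fun s : FFEtalePres X => s.n)
    (fun s => s.I) s) := s.etale

/-- The algebra of a presentation is faithfully flat. [folklore] -/
instance faithfullyFlat_block (s : FFEtalePres X) :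
    Module.FaithfullyFlat X (Block (fun s : FFEtalePres X => s.n) (fun s => s.I) s) := s.faithfullyFlat

/-- **Every faithfully flat étale algebra has a presentation.** [folklore] -/
theorem exists_of_algebra (Y : Type u) [CommRing Y] [Algebra X Y] [Algebra.Etale X Y]
    [Module.FaithfullyFlat X Y] :
    ∃ s : FFEtalePres X, Nonempty (Block (fun s : FFEtalePres X => s.n) (fun s => s.I) s ≃ₐ[X] Y) := by
  obtain ⟨n, π, hπ, -⟩ := Algebra.FinitePresentation.out (R := X) (A := Y)
  let e : (MvPolynomial (Fin n) X ⧸ RingHom.ker π) ≃ₐ[X] Y := Ideal.quotientKerAlgEquivOfSurjective hπ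
  haveI : Algebra.Etale X (MvPolynomial (Fin n) X ⧸ RingHom.ker π) := Algebra.Etale.of_equiv e.symm
  haveI : Module.FaithfullyFlat X (MvPolynomial (Fin n) X ⧸ RingHom.ker π) :=
    Module.FaithfullyFlat.of_linearEquiv X Y e.toLinearEquiv
  exact ⟨⟨n, RingHom.ker π, inferInstance, inferInstance⟩, ⟨e⟩⟩

end FFEtalePres

/-- **The cover `T(X)`**: the coproduct of all presented faithfully flat étale `X`-algebras.
[cite: StacksProject, Tag 097R] -/
abbrev ECover : Type u := Coprod (fun s : FFEtalePres X => s.n) (fun s => s.I)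

namespace ECover

/-- `T(X)` is ind-étale. [cite: StacksProject, Tag 097R] -/
theorem factorsEtale : FactorsEtale X (ECover X) := Coprod.factorsEtale _ _

/-- `T(X)` is faithfully flat. [cite: StacksProject, Tag 097R] -/
instance faithfullyFlat : Module.FaithfullyFlat X (ECover X) := Coprod.faithfullyFlat _ _

variable {X} in
/-- **`T(X)` absorbs every faithfully flat étale `X`-algebra**: there is an `X`-algebra map
`Y → T(X)`. [cite: StacksProject, Tag 097R] -/
theorem absorb (Y : Type u) [CommRing Y] [Algebra X Y] [Algebra.Etale X Y] [Module.FaithfullyFlat X Y] :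
    Nonempty (Y →ₐ[X] ECover X) := by
  obtain ⟨s, ⟨e⟩⟩ := FFEtalePres.exists_of_algebra (X := X) Y
  exact ⟨(Coprod.of _ _ s).comp e.symm.toAlgHom⟩

end ECover

/-! ### The tower `Tⁿ(X)` -/

/-- A bundled commutative `X`-algebra (for the recursion defining `Tⁿ(X)`). [folklore] -/
structure BAlg : Type (u + 1) where
  /-- the carrier -/
  carrier : Type u
  /-- its ring structure -/
  [isCommRing : CommRing carrier]
  /-- its `X`-algebra structure -/
  [isAlgebra : Algebra X carrier]

namespace BAlg

variable {X}

/-- The next floor `T(Y)` of the tower, as an `X`-algebra. [cite: StacksProject, Tag 097R] -/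
noncomputable def next (Y : BAlg X) : BAlg X :=
  letI := Y.isCommRing
  letI := Y.isAlgebra
  { carrier := ECover Y.carrier }

end BAlg

/-- The tower `n ↦ Tⁿ(X)` (bundled). [cite: StacksProject, Tag 097R] -/
noncomputable def eStageB : ℕ → BAlg X :=
  Nat.rec { carrier := X } fun _ Y => Y.next

/-- **`Tⁿ(X)`.** [cite: StacksProject, Tag 097R] -/
def EStage (n : ℕ) : Type u := (eStageB X n).carrier

/-- Ring structure of `Tⁿ(X)`. [folklore] -/
noncomputable instance EStage.instCommRing (n : ℕ) : CommRing (EStage X n) := (eStageB X n).isCommRing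

/-- `X`-algebra structure of `Tⁿ(X)`. [folklore] -/
noncomputable instance EStage.instAlgebra (n : ℕ) : Algebra X (EStage X n) := (eStageB X n).isAlgebra

/-- `Tⁿ⁺¹(X) = T(Tⁿ(X))` as a `Tⁿ(X)`-algebra. [folklore] -/
noncomputable instance EStage.instAlgebraSucc (n : ℕ) : Algebra (EStage X n) (EStage X (n + 1)) :=
  inferInstanceAs (Algebra (EStage X n) (ECover (EStage X n)))

/-- `X → Tⁿ(X) → Tⁿ⁺¹(X)`. [folklore] -/
instance EStage.isScalarTower_succ (n : ℕ) : IsScalarTower X (EStage X n) (EStage X (n + 1)) :=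
  inferInstanceAs (IsScalarTower X (EStage X n) (ECover (EStage X n)))

/-- `Tⁿ⁺¹(X)` is faithfully flat over `Tⁿ(X)`. [cite: StacksProject, Tag 097R] -/
instance EStage.faithfullyFlat_succ (n : ℕ) : Module.FaithfullyFlat (EStage X n) (EStage X (n + 1)) :=
  inferInstanceAs (Module.FaithfullyFlat (EStage X n) (ECover (EStage X n)))

/-- `Tⁿ⁺¹(X)` is ind-étale over `Tⁿ(X)`. [cite: StacksProject, Tag 097R] -/
theorem EStage.factorsEtale_succ (n : ℕ) : FactorsEtale (EStage X n) (EStage X (n + 1)) :=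
  ECover.factorsEtale (EStage X n)

/-- `Tⁿ⁺¹(X)` absorbs the faithfully flat étale `Tⁿ(X)`-algebras. [cite: StacksProject, Tag 097R] -/
theorem EStage.absorb_succ (n : ℕ) (Y : Type u) [CommRing Y] [Algebra (EStage X n) Y]
    [Algebra.Etale (EStage X n) Y] [Module.FaithfullyFlat (EStage X n) Y] :
    Nonempty (Y →ₐ[EStage X n] EStage X (n + 1)) :=
  ECover.absorb (X := EStage X n) Y

/-- The step maps `Tⁿ(X) → Tⁿ⁺¹(X)` as `X`-algebra maps. [folklore] -/
noncomputable def eStep (n : ℕ) : EStage X n →ₐ[X] EStage X (n + 1) :=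
  IsScalarTower.toAlgHom X (EStage X n) (EStage X (n + 1))

/-- The transition maps `Tⁿ(X) → Tᵐ(X)`, `n ≤ m`. [folklore] -/
noncomputable def eTrans (n : ℕ) : ∀ (m : ℕ), n ≤ m → (EStage X n →ₐ[X] EStage X m) :=
  fun _ h => Nat.leRec (motive := fun m _ => EStage X n →ₐ[X] EStage X m) (AlgHom.id X _)
    (fun m _ φ => (eStep X m).comp φ) h

/-- The transition map `Tⁿ → Tⁿ` is the identity. [folklore] -/
theorem eTrans_self (n : ℕ) : eTrans X n n le_rfl = AlgHom.id X _ :=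
  Nat.leRec_self _ _

/-- The transition map to the next floor. [folklore] -/
theorem eTrans_succ {n m : ℕ} (h : n ≤ m) :
    eTrans X n (m + 1) (Nat.le_succ_of_le h) = (eStep X m).comp (eTrans X n m h) :=
  Nat.leRec_succ _ _ h

/-- Transitivity of the transition maps. [folklore] -/
theorem eTrans_trans {n m k : ℕ} (hnm : n ≤ m) (hmk : m ≤ k) :
    eTrans X n k (hnm.trans hmk) = (eTrans X m k hmk).comp (eTrans X n m hnm) := by
  induction k, hmk using Nat.le_induction with
  | base => rw [eTrans_self, AlgHom.id_comp]
  | succ k hmk ih =>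
    rw [eTrans_succ X hmk, AlgHom.comp_assoc, ← ih]
    exact eTrans_succ X (hnm.trans hmk)

/-- The floors indexed in universe `u` (the colimit lemmas of `IndEtaleFactorization.lean` take
index types in `Type u`). [folklore] -/
def EStageU (k : ULift.{u} ℕ) : Type u := EStage X k.down

/-- Ring structure of the floors. [folklore] -/
noncomputable instance EStageU.instCommRing (k : ULift.{u} ℕ) : CommRing (EStageU X k) :=
  inferInstanceAs (CommRing (EStage X k.down))

/-- `X`-algebra structure of the floors. [folklore] -/
noncomputable instance EStageU.instAlgebra (k : ULift.{u} ℕ) : Algebra X (EStageU X k) :=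
  inferInstanceAs (Algebra X (EStage X k.down))

/-- The transition maps, indexed in universe `u`. [folklore] -/
noncomputable def eTransU (k l : ULift.{u} ℕ) (h : k ≤ l) : EStageU X k →ₐ[X] EStageU X l :=
  eTrans X k.down l.down h

/-- The tower is a directed system. [folklore] -/
instance eTransU_directedSystem : DirectedSystem (EStageU X) (eTransU X · · ·) where
  map_self := fun n x => by
    change eTrans X n.down n.down le_rfl x = x
    rw [eTrans_self]; rfl
  map_map := fun k m n hnm hmk x => by
    change eTrans X m.down k.down hmk (eTrans X n.down m.down hnm x) = eTrans X n.down k.down _ x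
    rw [eTrans_trans X hnm hmk]; rfl

/-- `ULift ℕ` is directed. [folklore] -/
instance isDirectedOrder_uliftNat : IsDirectedOrder (ULift.{u} ℕ) :=
  ⟨fun a b => ⟨⟨max a.down b.down⟩, le_max_left _ _, le_max_right _ _⟩⟩

/-- **The tower `C = colim_n Tⁿ(X)`.** [cite: StacksProject, Tag 097R] -/
abbrev ETower : Type u := DirectLimit (EStageU X) (eTransU X)


/-! ### `C = colim Tⁿ(X)` is ind-étale and faithfully flat over `X` and over every floor -/

/-- `Tⁿ(X)` is ind-étale over `X` (transitivity of the criterion along the tower).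
[cite: StacksProject, Tag 097R] -/
theorem EStage.factorsEtale (n : ℕ) : FactorsEtale X (EStage X n) := by
  induction n with
  | zero => exact FactorsEtale.of_etale (A := X) X
  | succ n ih => exact ih.trans (EStage.factorsEtale_succ X n)

/-- `Tⁿ(X)` is faithfully flat over `X`. [cite: StacksProject, Tag 097R] -/
instance EStage.faithfullyFlat (n : ℕ) : Module.FaithfullyFlat X (EStage X n) := by
  induction n with
  | zero => exact inferInstanceAs (Module.FaithfullyFlat X X)
  | succ n ih => exact Module.FaithfullyFlat.trans X (EStage X n) (EStage X (n + 1))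

/-- The floors (universe-lifted indices) are ind-étale over `X`. [folklore] -/
theorem EStageU.factorsEtale (k : ULift.{u} ℕ) : FactorsEtale X (EStageU X k) :=
  EStage.factorsEtale X k.down

/-- The floors (universe-lifted indices) are faithfully flat over `X`. [folklore] -/
instance EStageU.faithfullyFlat (k : ULift.{u} ℕ) : Module.FaithfullyFlat X (EStageU X k) :=
  inferInstanceAs (Module.FaithfullyFlat X (EStage X k.down))

/-- **`C = colim Tⁿ(X)` is ind-étale over `X`.** [cite: StacksProject, Tag 097R] -/
theorem ETower.factorsEtale : FactorsEtale X (ETower X) :=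
  FactorsEtale.directLimit (eTransU X) (EStageU.factorsEtale X)

/-- **`C = colim Tⁿ(X)` is faithfully flat over `X`.** [cite: StacksProject, Tag 097R] -/
instance ETower.faithfullyFlat : Module.FaithfullyFlat X (ETower X) :=
  faithfullyFlat_directLimit (eTransU X)

attribute [local instance] dlStageAlgebra

/-- The floor `k + 1` as an index. [folklore] -/
abbrev usucc (k : ULift.{u} ℕ) : ULift.{u} ℕ := ⟨k.down + 1⟩

/-- `k ≤ k + 1`. [folklore] -/
theorem le_usucc (k : ULift.{u} ℕ) : k ≤ usucc k := Nat.le_succ k.down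

/-- `T^{k+1}(X)` is a `Tᵏ(X)`-algebra (universe-lifted indices). [folklore] -/
noncomputable instance EStageU.instAlgebraSucc (k : ULift.{u} ℕ) :
    Algebra (EStageU X k) (EStageU X (usucc k)) :=
  inferInstanceAs (Algebra (EStage X k.down) (EStage X (k.down + 1)))

/-- `T^{k+1}(X) → C` as a `Tᵏ(X)`-algebra map. [folklore] -/
noncomputable def ETower.ofSucc (k : ULift.{u} ℕ) : EStageU X (usucc k) →ₐ[EStageU X k] ETower X :=
  { (DirectLimit.Algebra.of (EStageU X) (eTransU X) (usucc k)).toRingHom with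
    commutes' := fun x => by
      change DirectLimit.Algebra.of (EStageU X) (eTransU X) (usucc k) (eStep X k.down x) =
        DirectLimit.Algebra.of (EStageU X) (eTransU X) k x
      have h : eStep X k.down x = eTransU X k (usucc k) (le_usucc k) x := by
        change _ = eTrans X k.down (k.down + 1) _ x
        rw [eTrans_succ X le_rfl, eTrans_self]; rfl
      rw [h, DirectLimit.Algebra.of_f] }

/-- The floors `Tᵐ(X)`, `m ≥ n`, are faithfully flat over `Tⁿ(X)` (through the transition maps).
[cite: StacksProject, Tag 097R] -/
theorem EStage.faithfullyFlat_trans {n m : ℕ} (hm : n ≤ m) :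
    letI : Algebra (EStage X n) (EStage X m) := (eTrans X n m hm).toRingHom.toAlgebra
    Module.FaithfullyFlat (EStage X n) (EStage X m) := by
  induction m, hm using Nat.le_induction with
  | base =>
    rw [eTrans_self]
    exact (inferInstance : Module.FaithfullyFlat (EStage X n) (EStage X n))
  | succ m hm ih =>
    letI iA : Algebra (EStage X n) (EStage X m) := (eTrans X n m hm).toRingHom.toAlgebra
    letI iB : Algebra (EStage X n) (EStage X (m + 1)) :=
      (eTrans X n (m + 1) (Nat.le_succ_of_le hm)).toRingHom.toAlgebra
    haveI : IsScalarTower (EStage X n) (EStage X m) (EStage X (m + 1)) :=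
      IsScalarTower.of_algebraMap_eq fun x => by
        change eTrans X n (m + 1) (Nat.le_succ_of_le hm) x = eStep X m (eTrans X n m hm x)
        rw [eTrans_succ X hm]; rfl
    haveI : Module.FaithfullyFlat (EStage X n) (EStage X m) := ih
    exact Module.FaithfullyFlat.trans (EStage X n) (EStage X m) (EStage X (m + 1))

/-- The floors above `k` are faithfully flat over `Tᵏ(X)` (universe-lifted indices).
[cite: StacksProject, Tag 097R] -/
theorem EStageU.faithfullyFlat_ici (k : ULift.{u} ℕ) (j : {j // k ≤ j}) :
    Module.FaithfullyFlat (EStageU X k) (IciStage (eTransU X) k j) :=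
  EStage.faithfullyFlat_trans X (n := k.down) (m := j.1.down) j.2

/-- **`C` is faithfully flat over every floor `Tᵏ(X)`.** [cite: StacksProject, Tag 097R] -/
theorem ETower.faithfullyFlat_stage (k : ULift.{u} ℕ) : Module.FaithfullyFlat (EStageU X k) (ETower X) := by
  haveI : ∀ j, Module.FaithfullyFlat (EStageU X k) (IciStage (eTransU X) k j) :=
    EStageU.faithfullyFlat_ici X k
  haveI : Module.FaithfullyFlat (EStageU X k) (IciDirectLimit (eTransU X) k) :=
    faithfullyFlat_directLimit (iciTransition (eTransU X) k)
  exact Module.FaithfullyFlat.of_linearEquiv _ _ (iciEquiv (eTransU X) k).symm.toLinearEquiv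

/-! ### Étale algebras over a directed colimit descend to a stage -/

section Descent

variable {A : Type u} [CommRing A] {ι : Type u} [Preorder ι] [Nonempty ι] [IsDirectedOrder ι]
  {G : ι → Type u} [∀ i, CommRing (G i)] [∀ i, Algebra A (G i)]
  (f : ∀ i j, i ≤ j → G i →ₐ[A] G j) [DirectedSystem G (f · · ·)]

/-- **An étale algebra over a directed colimit has an étale model over some stage**:
`E ≅ colim G ⊗_{Gᵢ} E₀` with `E₀` étale over `Gᵢ` (Noetherian model over a finitely generated
subring, Mathlib `Algebra.Etale.exists_subalgebra_fg` = Tag 00U2 (8), and compactness of finitely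
presented rings). [cite: StacksProject, Tag 00U2] -/
theorem exists_etale_model (E : Type u) [CommRing E] [Algebra (DirectLimit G f) E]
    [Algebra.Etale (DirectLimit G f) E] :
    ∃ (i : ι) (E₀ : Type u) (_ : CommRing E₀) (_ : Algebra (G i) E₀) (_ : Algebra.Etale (G i) E₀),
      Nonempty (E ≃ₐ[DirectLimit G f] DirectLimit G f ⊗[G i] E₀) := by
  obtain ⟨A₀, E₀, _, _, hA₀, hE₀, ⟨e⟩⟩ :=
    Algebra.Etale.exists_subalgebra_fg (R := ℤ) (A := DirectLimit G f) (B := E)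
  have hFT : Algebra.FiniteType ℤ A₀ := ⟨(Subalgebra.fg_top A₀).mpr hA₀⟩
  have hpres : ∃ (n : ℕ) (π : MvPolynomial (Fin n) ℤ →+* A₀),
      Function.Surjective π ∧ (RingHom.ker π).FG := by
    obtain ⟨n, π, hπ⟩ := Algebra.FiniteType.iff_quotient_mvPolynomial''.1 hFT
    exact ⟨n, π.toRingHom, hπ, (isNoetherianRing_iff_ideal_fg _).1 inferInstance _⟩
  obtain ⟨i, φ₀, hφ₀⟩ :=
    exists_ringHom_factor_of_finitePresentation f A₀ hpres (algebraMap A₀ (DirectLimit G f))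
  letI : Algebra A₀ (G i) := φ₀.toAlgebra
  haveI : IsScalarTower A₀ (G i) (DirectLimit G f) :=
    IsScalarTower.of_algebraMap_eq fun a => (hφ₀ a).symm
  refine ⟨i, G i ⊗[A₀] E₀, inferInstance, inferInstance, inferInstance, ⟨?_⟩⟩
  exact e.trans (Algebra.TensorProduct.cancelBaseChange A₀ (G i) (DirectLimit G f)
    (DirectLimit G f) E₀).symm

end Descent

/-! ### The retraction property -/

/-- **Every faithfully flat étale algebra over `C = colim Tⁿ(X)` has a retraction** (Stacks
097R): it descends to a faithfully flat étale algebra over some `Tⁿ(X)`, which maps to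
`Tⁿ⁺¹(X) → C`. [cite: StacksProject, Tag 097R] -/
theorem ETower.retraction (Y : Type u) [CommRing Y] [Algebra (ETower X) Y] [Algebra.Etale (ETower X) Y]
    [Module.FaithfullyFlat (ETower X) Y] : Nonempty (Y →ₐ[ETower X] ETower X) := by
  obtain ⟨k, Y₀, _, _, _, ⟨e⟩⟩ := exists_etale_model (eTransU X) Y
  -- `Y` as a `Tᵏ(X)`-algebra, `Y₀ → Y`
  letI : Algebra (EStageU X k) Y :=
    ((algebraMap (ETower X) Y).comp (algebraMap (EStageU X k) (ETower X))).toAlgebra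
  haveI : IsScalarTower (EStageU X k) (ETower X) Y := IsScalarTower.of_algebraMap_eq fun _ => rfl
  let j : Y₀ →ₐ[EStageU X k] Y :=
    (e.symm.toAlgHom.restrictScalars (EStageU X k)).comp Algebra.TensorProduct.includeRight
  -- `Y₀` is faithfully flat over `Tᵏ(X)`
  haveI : Module.FaithfullyFlat (EStageU X k) (ETower X) := ETower.faithfullyFlat_stage X k
  haveI : Module.FaithfullyFlat (EStageU X k) Y :=
    Module.FaithfullyFlat.trans (EStageU X k) (ETower X) Y
  haveI : Module.FaithfullyFlat (EStageU X k) Y₀ := by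
    refine Module.FaithfullyFlat.of_comap_surjective fun p => ?_
    obtain ⟨Q, hQ⟩ := PrimeSpectrum.comap_surjective_of_faithfullyFlat (A := EStageU X k) (B := Y) p
    refine ⟨PrimeSpectrum.comap (j : Y₀ →+* Y) Q, ?_⟩
    rw [← hQ, ← PrimeSpectrum.comap_comp_apply, AlgHom.comp_algebraMap]
  -- absorb (over `T^{k}(X)`, into `T^{k+1}(X)`) and retract
  letI : Algebra (EStage X k.down) Y₀ := ‹Algebra (EStageU X k) Y₀›
  haveI : Algebra.Etale (EStage X k.down) Y₀ := ‹Algebra.Etale (EStageU X k) Y₀›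
  haveI : Module.FaithfullyFlat (EStage X k.down) Y₀ := ‹Module.FaithfullyFlat (EStageU X k) Y₀›
  obtain ⟨a⟩ := EStage.absorb_succ X k.down Y₀
  let ψ₀ : Y₀ →ₐ[EStageU X k] ETower X := (ETower.ofSucc X k).comp a
  exact ⟨(Algebra.TensorProduct.lift (AlgHom.id (ETower X) (ETower X)) ψ₀ fun _ _ => Commute.all _ _).comp
    e.toAlgHom⟩

end Literature.RingTheory.Etale
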